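import Summits.AtomisticToContinuum.FouriersLaw.Theorems.BondHeatUncertaintySubdiffusiveBondHeatJunctionChannelExclusion

/-!
# One good scale suffices: `BufferedJunctionLaw ∧ NonBallistic ⟹ 11071`, and the dichotomy «Ohmic or resistance-capped»

Support file for stmt-AtomisticToContinuum-11071 (`BondHeatUncertainty.BoundedResponse`; residual of record 11071 ∧ 9121),
decomposition cell `decomp-a2c`, lens-1 (grading), gen 57 — file (9) (imports (8) `…JunctionChannelExclusion`).

File (8) showed that the balanced-split law `SplitLaw 0` (ONE split per length, existentially given) needs only `E_N → 0` on the floor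
side.  The FREE-split laws of file (5) — `BufferedJunctionLaw` (`∀ u v ≥ N₂: 1/E_u + 1/E_v − C ≤ 1/E_{u+L₀+v}`) and its supplier
`LocalityPassivityLaw` — need even less: ONE GOOD SCALE.  If a single `N⋆ ≥ max N₂ 2` has `1/E_{N⋆} ≥ C + c` with `c > 0`, chaining
copies of the `N⋆`-block across buffers (`N = m + k(N⋆ + L₀)`, remainder block `m ∈ [N₂, N₂ + N⋆ + L₀)` of resistance `≥ 0`) gives
`1/E_N ≥ k·c ≥ (c / 2(N⋆+L₀))·N`, the Ohmic floor (`linear_of_bufferedJunction_of_goodScale`, pure sequence analysis; no Fekete limit,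
no positivity or conductance-lower-bound input).  Consequences:

* DICHOTOMY per temperature (`ohmicAt_or_resistanceCapped_of_bufferedJunctionAt`): under the buffered junction law with constants
  `(C, L₀, N₂)` at `T`, EITHER `E_N(T) ≤ C₁/N` eventually (Ohmic), OR `1/E_N(T) ≤ C` for EVERY `N ≥ max N₂ 2` (resistance capped by the
  junction defect: uniformly ballistic, `D_N ≥ (N−1)γ/C`).  Nothing in between: no anomalous exponent, no sparse sub-ballistic scales.
* THE NODE WITH THE WEAKEST TYPED PARTNER: `boundedResponse_of_bufferedJunctionLaw_of_nonBallistic :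
  BufferedJunctionLaw → NonBallistic → BoundedResponse` and `boundedResponse_of_localityPassivityLaw_of_nonBallistic`, where
  `NonBallistic` is stmt-9127 (≡ SuperadditiveJunction's crux stmt-2192; `liminf_N D_N/(N−1) ≤ 0`: "the conductance is not bounded away
  from zero") — WEAKER than `NoBallisticChannel` 28286 (`nonBallistic_of_noBallisticChannel`) and supplied in the tree, modulo cruxes, by
  `(K) = ExtensiveSnapshotIrreversibility` 9121 (`…LightConeBondHeatTentNonBallistic`, `…WindowedTransfer`; CurrentTiltQuench p156168).
* Escape-deficit currency `EscapeInfZero` (`∀ T ∀ ε > 0`, `E_N(T) ≤ ε` for arbitrarily large `N`) with the bridge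
  `escapeInfZero_iff_nonBallistic` (response identity + uniqueness + existence, by name), and the edges `EscapeVanishing → EscapeInfZero`,
  `NoBallisticChannel → NonBallistic` (28286 ⟹ 9127), `BoundedResponse → NonBallistic` (11071 ⟹ 9127).

Relation to route `JunctionLocality`: its proved kernel `SuperadditiveFekete` runs the same «one good scale» idea for the EXACT junction
(`R_{N+M} ≥ R_N + R_M − C`, no buffer = `JunctionLaw 0`, dead in evidence at `θ = 0` without buffer) and needs `PositiveConductance` and
`ConductanceLowerBound` to produce the LIMIT; here the buffer `L₀` is carried, only the bounded-response half (11071) is extracted, and no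
positivity / lower-bound crux enters (`E_N > 0` is the tree theorem `escapeDeficit_pos`).

DOCKET (lens-1, gen 57, final): 11071 ⟸ `LocalityPassivityLaw` ∧ `NonBallistic` (9127); given `LocalityPassivityLaw`, the response at
each temperature is Ohmic or resistance-capped (uniformly ballistic) — the junction mechanism carries ALL the Fourier content except
«not uniformly ballistic».  What this file does NOT do: prove `BufferedJunctionLaw`, `LocalityPassivityLaw` or `NonBallistic`.
No `sorry`; standard axioms; nothing here closes an item.
-/

noncomputable section

open MeasureTheory Filter Topology Set
open scoped BigOperators

namespace Summit.AtomisticToContinuum.FouriersLaw.Theorems.SubdiffusiveBondHeat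

namespace EscapeGrading

open Literature.MathematicalPhysics.KineticTheory.HeatConduction
open Summit.AtomisticToContinuum.FouriersLaw.Theses.BondHeatUncertainty (BoundedResponse NonBallistic)
open Summit.AtomisticToContinuum.FouriersLaw.Theses.ChannelExclusionTauberian (NoBallisticChannel)

/-! ## The kernel: one good scale across buffers (pure sequence analysis) -/

/-- **Chaining lemma.**  Under `r_u + r_v − C ≤ r_{u+L₀+v}` (`u, v ≥ N₂`) and a good scale `N⋆ ≥ N₂` with `C + c ≤ r_{N⋆}`:
`r_m + k·c ≤ r_{m + k(N⋆+L₀)}` for every `m ≥ N₂` and `k`. [kernel] -/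
theorem chain_of_bufferedJunction {r : ℕ → ℝ} {C c : ℝ} {L₀ N₂ Ns : ℕ}
    (hJ : ∀ u v : ℕ, N₂ ≤ u → N₂ ≤ v → r u + r v - C ≤ r (u + L₀ + v)) (hNs : N₂ ≤ Ns) (hgood : C + c ≤ r Ns) :
    ∀ k m : ℕ, N₂ ≤ m → r m + k * c ≤ r (m + k * (Ns + L₀)) := by
  intro k
  induction k with
  | zero => intro m _; simp
  | succ k ih =>
    intro m hm
    have h1 := ih m hm
    have h2 := hJ (m + k * (Ns + L₀)) Ns (le_trans hm (Nat.le_add_right _ _)) hNs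
    have e : m + k * (Ns + L₀) + L₀ + Ns = m + (k + 1) * (Ns + L₀) := by ring
    rw [e] at h2
    push_cast
    linarith

/-- **THE KERNEL — one good scale suffices.**  If `r ≥ 0` beyond `N₂`, `r_u + r_v − C ≤ r_{u+L₀+v}` for `u, v ≥ N₂`, and ONE scale
`N⋆ ≥ max N₂ 1` has `C + c ≤ r_{N⋆}` with `c > 0`, then `a·N ≤ r_N` for `N ≥ 2(N₂ + N⋆ + L₀)`, `a = c/(2(N⋆+L₀))`: write
`N = m + k(N⋆+L₀)` with `m ∈ [N₂, N₂+N⋆+L₀)` and chain. [kernel] -/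
theorem linear_of_bufferedJunction_of_goodScale {r : ℕ → ℝ} {C c : ℝ} {L₀ N₂ Ns : ℕ}
    (hr0 : ∀ n : ℕ, N₂ ≤ n → 0 ≤ r n) (hc : 0 < c)
    (hJ : ∀ u v : ℕ, N₂ ≤ u → N₂ ≤ v → r u + r v - C ≤ r (u + L₀ + v))
    (hNs : N₂ ≤ Ns) (hNs1 : 1 ≤ Ns) (hgood : C + c ≤ r Ns) :
    ∃ a : ℝ, 0 < a ∧ ∃ N₀ : ℕ, ∀ N : ℕ, N₀ ≤ N → a * (N : ℝ) ≤ r N := by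
  obtain ⟨P, hP⟩ : ∃ P : ℕ, P = Ns + L₀ := ⟨_, rfl⟩
  have hP1 : 1 ≤ P := by omega
  have hPpos : (0 : ℝ) < P := by exact_mod_cast hP1
  refine ⟨c / (2 * P), by positivity, 2 * (N₂ + P), fun N hN => ?_⟩
  -- Euclidean division of `N − N₂` by `P`
  obtain ⟨k, hk⟩ : ∃ k : ℕ, k = (N - N₂) / P := ⟨_, rfl⟩
  have hle : k * P ≤ N - N₂ := by rw [hk]; exact Nat.div_mul_le_self (N - N₂) P
  have hlt : N - N₂ < k * P + P := by rw [hk]; exact Nat.lt_div_mul_add hP1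
  have hN₂N : N₂ ≤ N := by omega
  obtain ⟨m, hm⟩ : ∃ m : ℕ, m = N - k * P := ⟨_, rfl⟩
  have hmN₂ : N₂ ≤ m := by omega
  have hNmk : N = m + k * (Ns + L₀) := by rw [← hP]; omega
  have hchain := chain_of_bufferedJunction hJ hNs hgood k m hmN₂
  rw [← hNmk] at hchain
  have hrm := hr0 m hmN₂
  -- `k ≥ (N − N₂ − P)/P ≥ N/(2P)` in `ℝ`
  have hkR : ((N : ℝ) - N₂) < (k : ℝ) * P + P := by
    rw [← Nat.cast_sub hN₂N]
    exact_mod_cast hlt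
  have hNR : (2 : ℝ) * (N₂ + P) ≤ N := by exact_mod_cast hN
  have hkc : c / (2 * P) * (N : ℝ) ≤ (k : ℝ) * c := by
    rw [div_mul_eq_mul_div, div_le_iff₀ (by positivity)]
    nlinarith
  linarith

/-! ## Per temperature: the Ohmic floor from one good scale, and the dichotomy -/

/-- **Per-temperature kernel in escape-deficit currency.**  Under the buffered junction law with constants `(C, L₀, N₂)` at `T`, a single
`N⋆ ≥ max N₂ 2` with `C + c ≤ 1/E_{N⋆}(T)`, `c > 0`, gives `E_N(T) ≤ C₁/N` eventually (`1/E_N ≥ 1 ≥ 0` by `escapeDeficit_pos`,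
`escapeDeficit_le_one`). [kernel] -/
theorem escapeFloor_one_of_bufferedJunctionAt_of_goodScale {ω₂ lam β γ T : ℝ} (hω : 0 < ω₂) (hl : 0 < lam) (hβ : 0 < β)
    (hγ : 0 < γ) (hT : 0 < T) {C c : ℝ} {L₀ N₂ Ns : ℕ} (hc : 0 < c)
    (hJ : ∀ u v : ℕ, N₂ ≤ u → N₂ ≤ v →
      1 / escapeDeficit ω₂ lam β γ T u + 1 / escapeDeficit ω₂ lam β γ T v - C ≤ 1 / escapeDeficit ω₂ lam β γ T (u + L₀ + v))
    (hNs : max N₂ 2 ≤ Ns) (hgood : C + c ≤ 1 / escapeDeficit ω₂ lam β γ T Ns) :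
    ∃ C₁ : ℝ, ∃ N₀ : ℕ, ∀ N : ℕ, N₀ ≤ N → escapeDeficit ω₂ lam β γ T N ≤ C₁ / (N : ℝ) := by
  have hpos : ∀ N : ℕ, 2 ≤ N → 0 < escapeDeficit ω₂ lam β γ T N := fun N hN =>
    JunctionDefectGrading.escapeDeficit_pos hω hl hβ hγ hT hN
  -- restrict the law to `u, v ≥ max N₂ 2`, where `1/E ≥ 0`
  have hJ' : ∀ u v : ℕ, max N₂ 2 ≤ u → max N₂ 2 ≤ v →
      1 / escapeDeficit ω₂ lam β γ T u + 1 / escapeDeficit ω₂ lam β γ T v - C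
        ≤ 1 / escapeDeficit ω₂ lam β γ T (u + L₀ + v) := fun u v hu hv =>
    hJ u v (le_trans (le_max_left _ _) hu) (le_trans (le_max_left _ _) hv)
  have hr0 : ∀ n : ℕ, max N₂ 2 ≤ n → 0 ≤ 1 / escapeDeficit ω₂ lam β γ T n := fun n hn =>
    (one_div_pos.2 (hpos n (le_trans (le_max_right _ _) hn))).le
  obtain ⟨a, ha, N₀, hlin⟩ := linear_of_bufferedJunction_of_goodScale
    (r := fun N => 1 / escapeDeficit ω₂ lam β γ T N) hr0 hc hJ' hNs (le_trans (by omega) hNs) hgood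
  refine ⟨1 / a, max N₀ 2, fun N hN => ?_⟩
  have hE := hpos N (le_trans (le_max_right _ _) hN)
  have hNpos : (0 : ℝ) < N := by
    exact_mod_cast lt_of_lt_of_le (by norm_num) (le_trans (le_max_right N₀ 2) hN)
  have h : a * (N : ℝ) ≤ 1 / escapeDeficit ω₂ lam β γ T N := hlin N (le_trans (le_max_left _ _) hN)
  have h' : a * (N : ℝ) * escapeDeficit ω₂ lam β γ T N ≤ 1 := (le_div_iff₀ hE).mp h
  rw [div_div, le_div_iff₀ (mul_pos ha hNpos)]
  calc escapeDeficit ω₂ lam β γ T N * (a * N) = a * (N : ℝ) * escapeDeficit ω₂ lam β γ T N := by ring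
    _ ≤ 1 := h'

/-- **DICHOTOMY «Ohmic or resistance-capped».**  Under the buffered junction law with constants `(C, L₀, N₂)` at `T`: EITHER the Ohmic
floor `E_N(T) ≤ C₁/N` eventually, OR `1/E_N(T) ≤ C` for every `N ≥ max N₂ 2` (the escape resistance never exceeds the junction defect:
uniformly ballistic response `D_N ≥ (N−1)γ/C`).  No anomalous exponent and no sparse set of good scales can occur. [kernel] -/
theorem ohmicAt_or_resistanceCapped_of_bufferedJunctionAt {ω₂ lam β γ T : ℝ} (hω : 0 < ω₂) (hl : 0 < lam) (hβ : 0 < β)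
    (hγ : 0 < γ) (hT : 0 < T) {C : ℝ} {L₀ N₂ : ℕ}
    (hJ : ∀ u v : ℕ, N₂ ≤ u → N₂ ≤ v →
      1 / escapeDeficit ω₂ lam β γ T u + 1 / escapeDeficit ω₂ lam β γ T v - C ≤ 1 / escapeDeficit ω₂ lam β γ T (u + L₀ + v)) :
    (∃ C₁ : ℝ, ∃ N₀ : ℕ, ∀ N : ℕ, N₀ ≤ N → escapeDeficit ω₂ lam β γ T N ≤ C₁ / (N : ℝ)) ∨
      (∀ N : ℕ, max N₂ 2 ≤ N → 1 / escapeDeficit ω₂ lam β γ T N ≤ C) := by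
  by_cases h : ∀ N : ℕ, max N₂ 2 ≤ N → 1 / escapeDeficit ω₂ lam β γ T N ≤ C
  · exact Or.inr h
  · left
    push Not at h
    obtain ⟨Ns, hNs, hgt⟩ := h
    exact escapeFloor_one_of_bufferedJunctionAt_of_goodScale hω hl hβ hγ hT
      (c := 1 / escapeDeficit ω₂ lam β γ T Ns - C) (by linarith) hJ hNs (by linarith)

/-! ## `EscapeInfZero` — the escape-deficit currency of `NonBallistic` (stmt-9127 ≡ stmt-2192) -/

/-- **Escape deficit not bounded away from zero:** for all parameters, every `T > 0` and `ε > 0`, `E_N(T) ≤ ε` for arbitrarily large `N`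
(`liminf_N E_N(T) = 0`).  EQUIV to `NonBallistic` 9127 (`escapeInfZero_iff_nonBallistic`); WEAKER than `EscapeVanishing` (≡ 28286);
phonon-false; UNDECIDED (open).  Typed as the weakest floor-side partner of the free-split junction laws. [piece · rung] -/
def EscapeInfZero : Prop :=
  ∀ ω₂ lam β γ : ℝ, 0 < ω₂ → 0 < lam → 0 < β → 0 < γ → ∀ T : ℝ, 0 < T →
    ∀ ε : ℝ, 0 < ε → ∀ M : ℕ, ∃ N : ℕ, M ≤ N ∧ escapeDeficit ω₂ lam β γ T N ≤ ε

/-- `EscapeVanishing → EscapeInfZero` (a limit is a liminf). [folklore] -/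
theorem escapeInfZero_of_escapeVanishing (hV : EscapeVanishing) : EscapeInfZero := by
  intro ω₂ lam β γ hω hl hβ hγ T hT ε hε M
  obtain ⟨N₁, hN₁⟩ := eventually_atTop.1 ((hV ω₂ lam β γ hω hl hβ hγ T hT).eventually (ge_mem_nhds hε))
  exact ⟨max N₁ M, le_max_right _ _, hN₁ _ (le_max_left _ _)⟩

/-! ## The free-split node, escape-deficit currency -/

/-- **`BufferedJunctionLaw → EscapeInfZero → OhmicFloor`** — one good scale per temperature. [kernel · frame] -/
theorem ohmicFloor_of_bufferedJunctionLaw_of_escapeInfZero (hB : JunctionDefectGrading.BufferedJunctionLaw) (hI : EscapeInfZero) :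
    OhmicFloor := by
  intro ω₂ lam β γ hω hl hβ hγ T hT
  obtain ⟨C, hC, L₀, N₂, hJ⟩ := hB ω₂ lam β γ hω hl hβ hγ T hT
  have hδ : (0 : ℝ) < 1 / (C + 1) := by positivity
  obtain ⟨Ns, hNs, hle⟩ := hI ω₂ lam β γ hω hl hβ hγ T hT (1 / (C + 1)) hδ (max N₂ 2)
  have hE : 0 < escapeDeficit ω₂ lam β γ T Ns :=
    JunctionDefectGrading.escapeDeficit_pos hω hl hβ hγ hT (le_trans (le_max_right _ _) hNs)
  have hgood : C + 1 ≤ 1 / escapeDeficit ω₂ lam β γ T Ns := (le_one_div (by positivity) hE).2 hle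
  exact escapeFloor_one_of_bufferedJunctionAt_of_goodScale hω hl hβ hγ hT one_pos hJ hNs hgood

/-- **`BufferedJunctionLaw → EscapeInfZero → BoundedResponse` (11071).** [kernel · frame] -/
theorem boundedResponse_of_bufferedJunctionLaw_of_escapeInfZero (hB : JunctionDefectGrading.BufferedJunctionLaw)
    (hI : EscapeInfZero) : BoundedResponse :=
  ohmicFloor_iff_boundedResponse.1 (ohmicFloor_of_bufferedJunctionLaw_of_escapeInfZero hB hI)

/-- **`LocalityPassivityLaw → EscapeInfZero → BoundedResponse`** (file (5): `bufferedJunctionLaw_of_localityPassivityLaw`). [kernel · frame] -/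
theorem boundedResponse_of_localityPassivityLaw_of_escapeInfZero (hL : JunctionDefectGrading.LocalityPassivityLaw)
    (hI : EscapeInfZero) : BoundedResponse :=
  boundedResponse_of_bufferedJunctionLaw_of_escapeInfZero (JunctionDefectGrading.bufferedJunctionLaw_of_localityPassivityLaw hL) hI

/-! ## The bridge to the ledger item: `EscapeInfZero ⟺ NonBallistic` (stmt-9127) -/

/-- **`EscapeInfZero ⟹ NonBallistic`.**  Along ANY steady-state family with response coefficients `D`: `D_N = (N−1)γE_N` (`N ≥ 1`, response
identity + uniqueness of limits); a scale `N ≥ max N₀ 2` with `E_N ≤ ε/γ` has `D_N ≤ ε(N−1)`. [folklore] -/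
theorem nonBallistic_of_escapeInfZero (hI : EscapeInfZero) : NonBallistic := by
  intro ω₂ lam β γ hω hl hβ hγ _ μ hμ T hT D hD ε hε N₀
  have huniq := bondHeatUncertainty_nessUnique_holds ω₂ lam β γ hω hl hβ hγ
  have hRI := boundaryEscapeDeficit_responseIdentity_holds ω₂ lam β γ hω hl hβ hγ huniq μ hμ T hT
  dsimp only at hRI
  obtain ⟨N, hN, hle⟩ := hI ω₂ lam β γ hω hl hβ hγ T hT (ε / γ) (by positivity) (max N₀ 2)
  have hN1 : 0 < N := lt_of_lt_of_le (by norm_num) (le_trans (le_max_right N₀ 2) hN)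
  have hDN : D N = ((N : ℝ) - 1) * γ * escapeDeficit ω₂ lam β γ T N := tendsto_nhds_unique (hD N) (hRI N hN1).2
  refine ⟨N, le_trans (le_max_left _ _) hN, ?_⟩
  have hN1' : (1 : ℝ) ≤ N := by exact_mod_cast hN1
  have hγE : γ * escapeDeficit ω₂ lam β γ T N ≤ ε := by
    have h := mul_le_mul_of_nonneg_left hle hγ.le
    rwa [mul_div_cancel₀ _ hγ.ne'] at h
  rw [hDN]
  have e1 : ((N : ℝ) - 1) * γ * escapeDeficit ω₂ lam β γ T N = (γ * escapeDeficit ω₂ lam β γ T N) * ((N : ℝ) - 1) := by ring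
  rw [e1]
  exact mul_le_mul_of_nonneg_right hγE (by linarith)

/-- **`NonBallistic ⟹ EscapeInfZero`.**  Along the canonical steady-state family (existence + choice) with `D_N := (N−1)γE_N`
(`D_0 = 0`): a scale `N ≥ max M 2` with `D_N ≤ εγ(N−1)` has `E_N ≤ ε`. [folklore] -/
theorem escapeInfZero_of_nonBallistic (hB : NonBallistic) : EscapeInfZero := by
  intro ω₂ lam β γ hω hl hβ hγ T hT ε hε M
  classical
  have huniq := bondHeatUncertainty_nessUnique_holds ω₂ lam β γ hω hl hβ hγ
  let μ₀ : (N : ℕ) → ℝ → ℝ → MeasureTheory.Measure (PhaseSpace N) := fun N T_L T_R =>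
    if h : 0 < T_L ∧ 0 < T_R then
      Classical.choose (pinnedChain_exists_isSteadyState hω hl hβ hγ N h.1 h.2) else 0
  have hμ₀ : ∀ (N : ℕ) (T_L T_R : ℝ), 0 < T_L → 0 < T_R →
      (pinnedChain ω₂ lam β γ).IsSteadyState N T_L T_R (μ₀ N T_L T_R) := by
    intro N T_L T_R hL' hR'
    simp only [μ₀, dif_pos (And.intro hL' hR')]
    exact Classical.choose_spec (pinnedChain_exists_isSteadyState hω hl hβ hγ N hL' hR')
  have hRI := boundaryEscapeDeficit_responseIdentity_holds ω₂ lam β γ hω hl hβ hγ huniq μ₀ hμ₀ T hT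
  dsimp only at hRI
  let D : ℕ → ℝ := fun N => if N = 0 then 0 else ((N : ℝ) - 1) * γ * escapeDeficit ω₂ lam β γ T N
  have hDpos : ∀ N : ℕ, 0 < N → D N = ((N : ℝ) - 1) * γ * escapeDeficit ω₂ lam β γ T N := fun N hN => by
    simp [D, hN.ne']
  have hD : ∀ N : ℕ, Tendsto
      (fun δ : ℝ => (pinnedChain ω₂ lam β γ).totalCurrent (μ₀ N (T + δ / 2) (T - δ / 2)) / δ)
      (𝓝[≠] 0) (𝓝 (D N)) := by
    intro N
    rcases Nat.eq_zero_or_pos N with rfl | hN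
    · have hD0 : D 0 = 0 := by simp [D]
      rw [hD0]
      simp only [OscillatorChain.totalCurrent_zero, zero_div]
      exact tendsto_const_nhds
    · rw [hDpos N hN]
      exact (hRI N hN).2
  obtain ⟨N, hN, hle⟩ := hB ω₂ lam β γ hω hl hβ hγ huniq μ₀ hμ₀ T hT D hD (ε * γ) (by positivity) (max M 2)
  have hN2 : 2 ≤ N := le_trans (le_max_right _ _) hN
  refine ⟨N, le_trans (le_max_left _ _) hN, ?_⟩
  rw [hDpos N (by omega)] at hle
  have hN1 : (0 : ℝ) < (N : ℝ) - 1 := by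
    have : (2 : ℝ) ≤ N := by exact_mod_cast hN2
    linarith
  -- `(N−1)·(γE_N) ≤ (N−1)·(εγ)` ⟹ `γE_N ≤ γε` ⟹ `E_N ≤ ε`
  have h1 : ((N : ℝ) - 1) * (γ * escapeDeficit ω₂ lam β γ T N) ≤ ((N : ℝ) - 1) * (ε * γ) := by
    have e : ((N : ℝ) - 1) * γ * escapeDeficit ω₂ lam β γ T N = ((N : ℝ) - 1) * (γ * escapeDeficit ω₂ lam β γ T N) := by ring
    rw [e] at hle
    linarith
  have h2 : γ * escapeDeficit ω₂ lam β γ T N ≤ ε * γ := le_of_mul_le_mul_left h1 hN1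
  nlinarith

/-- **`EscapeInfZero ⟺ NonBallistic` (stmt-9127).** [folklore] -/
theorem escapeInfZero_iff_nonBallistic : EscapeInfZero ↔ NonBallistic :=
  ⟨nonBallistic_of_escapeInfZero, escapeInfZero_of_nonBallistic⟩

/-! ## THE NODE with the weakest typed partner: 11071 ⟸ (free-split junction piece) ∧ `NonBallistic` -/

/-- **`BufferedJunctionLaw → NonBallistic → BoundedResponse`.** [kernel · frame] -/
theorem boundedResponse_of_bufferedJunctionLaw_of_nonBallistic (hJ : JunctionDefectGrading.BufferedJunctionLaw)
    (hN : NonBallistic) : BoundedResponse :=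
  boundedResponse_of_bufferedJunctionLaw_of_escapeInfZero hJ (escapeInfZero_of_nonBallistic hN)

/-- **NODE OF RECORD (weakest partner): `LocalityPassivityLaw → NonBallistic → BoundedResponse`** — 11071 from junction locality + buffer
passivity (file (5)) and stmt-9127 «the conductance is not bounded away from zero». [kernel · frame] -/
theorem boundedResponse_of_localityPassivityLaw_of_nonBallistic (hL : JunctionDefectGrading.LocalityPassivityLaw)
    (hN : NonBallistic) : BoundedResponse :=
  boundedResponse_of_localityPassivityLaw_of_escapeInfZero hL (escapeInfZero_of_nonBallistic hN)

/-! ## Edges between the partners -/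

/-- `NoBallisticChannel → NonBallistic` (stmt-28286 ⟹ stmt-9127). [folklore] -/
theorem nonBallistic_of_noBallisticChannel (h : NoBallisticChannel) : NonBallistic :=
  nonBallistic_of_escapeInfZero (escapeInfZero_of_escapeVanishing (escapeVanishing_of_noBallisticChannel h))

/-- `BoundedResponse → NonBallistic` (11071 ⟹ stmt-9127): the partner is WEAKER than the blocker. [folklore] -/
theorem nonBallistic_of_boundedResponse (h : BoundedResponse) : NonBallistic :=
  nonBallistic_of_noBallisticChannel (noBallisticChannel_of_boundedResponse h)

/-- `ExponentFloor s → NonBallistic` (`s > 0`) and hence `CurrentCorrectorBudget a → NonBallistic` (`a < 3`), E1 `→ NonBallistic`. [folklore] -/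
theorem nonBallistic_of_exponentFloor {s : ℝ} (hs : 0 < s) (hF : ExponentFloor s) : NonBallistic :=
  nonBallistic_of_noBallisticChannel (noBallisticChannel_of_exponentFloor hs hF)

end EscapeGrading

end Summit.AtomisticToContinuum.FouriersLaw.Theorems.SubdiffusiveBondHeat

end
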